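import Literature.NumberTheory.Automorphic.DistanceRegularHeckeShellCount
import HarnessLib

/-!
# A contracting transversal of `KtK/K` is automatically distance-regular: `X = {u·t : u ∈ K_N} ∪ X₀ ∪ {t⁻¹}` with `t K_N t⁻¹ ≤ K_N ≤ K`,
# `t X₀ t⁻¹ ⊆ K_N` splits `|X₊| ∕ |X₀| ∕ 1` over the shells `K t^{n+1} K ∕ K tⁿ K ∕ K t^{n-1} K` for EVERY `n ≥ 1`
# (Bruhat–Tits 1972 (4.4.4); Serre *Trees* II.1.1; Macdonald 1971 Ch. V)

Topic `NumberTheory/Automorphic`; namespace `Literature.NumberTheory.Automorphic.SphericalCoefficient`.  THEOREMS ONLY; no definition,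
no named fact, no instance, no notation, no `sorry`.  Cell `hodgecm-mathlib`, fan-B row #90 (SqNS) ∕ #79 (XP) pay-down, road (B) «local»,
brick (L2-gen): the distance-regularity hypothesis `hreg` of ★ `SphericalCoefficient.not_isSquareIntegrableModCenter_of_isSpherical_of_symm` (L4γ,
`DistanceRegularHeckeShellCount`) is DISCHARGED GENERICALLY for transversals in contracting form.

## The mathematics

Let `K_N ≤ K ≤ G` be subgroups and `t ∈ G` with `t K_N t⁻¹ ≤ K_N` (conjugation by `t` contracts `K_N`).  Then `tⁿ u t⁻ⁿ ∈ K_N` for all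
`u ∈ K_N`, `n ∈ ℕ` (`conj_pow_mem`), so
* for `x = u·t` with `u ∈ K_N`:  `tⁿ x = (tⁿ u t⁻ⁿ) · t^{n+1} ∈ K t^{n+1} K` (`pow_mul_mem_doubleCoset_succ_of_mul_inv_mem`);
* for `x` with `t x t⁻¹ ∈ K_N`:  `tⁿ x = (t^{n-1} (t x t⁻¹) t^{-(n-1)}) · tⁿ ∈ K tⁿ K` for `n ≥ 1` (`pow_mul_mem_doubleCoset_self_of_conj_mem`);
* `tⁿ t⁻¹ = t^{n-1} ∈ K t^{n-1} K` for `n ≥ 1` (`pow_mul_inv_mem_doubleCoset_pred`).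
Hence if `X = X₊ ∪ X₀ ∪ {t⁻¹}` with `x t⁻¹ ∈ K_N` on `X₊` and `t x t⁻¹ ∈ K_N` on `X₀`, and the shells `K t^m K` are pairwise disjoint, then for
every `n ≥ 1` the translates `tⁿ x` (`x ∈ X`) lie in `K t^{n+1} K`, `K tⁿ K`, `K t^{n-1} K` according as `x ∈ X₊`, `x ∈ X₀`, `x = t⁻¹`, with
counts `|X₊|`, `|X₀|`, `1` — the three pieces being forced pairwise disjoint by the disjointness of the shells at `n = 1`
(`ncard_translates_of_contracting`).  This is the radius-one neighbour pattern `(ab, b-1, 1)` of a semi-homogeneous tree seen from a vertex of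
the OTHER colour class than its neighbours' [SerreTrees1980 II.1.1], in the purely group-theoretic form in which the Iwasawa cells of the
hyperspecial double coset `K t K` of an unramified rank-one group present themselves [BruhatTits1972 (4.4.4)]: `q_{2a}q_a` cosets `u t K`
(`u ∈ K_N ∕ t K_N t⁻¹`), `q_a - 1` cosets of level `0`, and the one coset `t⁻¹ K`.
Junction (§3): ★ L4γ with `hreg` so discharged — **`not_isSquareIntegrableModCenter_of_isSpherical_of_contracting`**: a smooth `K`-spherical
representation of such a `(G, K, t)` with `|X₊| = ab`, `|X₀| = b - 1`, `b ≤ a`, `ab ≥ 2` is not square-integrable modulo the centre.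
HC_CM is proved only modulo the printed citations until rung 0 closes; this file is unconditional and generic.

## What is formalised
* §1 `conj_pow_mem`, `pow_mul_mem_doubleCoset_succ_of_mul_inv_mem`, `pow_mul_mem_doubleCoset_self_of_conj_mem`, `pow_mul_inv_mem_doubleCoset_pred`.
* §2 `not_mem_of_translates_disjoint` (plumbing), **`ncard_translates_of_contracting`** (the three counts + the three-way split for every `n ≥ 1`),
  `card_contractingTransversal` (`#X = |X₊| + |X₀| + 1`).
* §3 **`not_isSquareIntegrableModCenter_of_isSpherical_of_contracting`**.
-/

noncomputable section

open MeasureTheory MulAction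
open scoped Pointwise

namespace Literature.NumberTheory.Automorphic.SphericalCoefficient

/-! ## §1 Contraction and the three shell memberships -/

section Contracting

variable {G : Type*} [Group G] {K KN : Subgroup G} {t : G}

/-- If conjugation by `t` maps `K_N` into itself then so does conjugation by `tⁿ`: `tⁿ u (tⁿ)⁻¹ ∈ K_N` for `u ∈ K_N`.
[cite: BruhatTits1972, (4.4.4)] -/
theorem conj_pow_mem (ht : ∀ u ∈ KN, t * u * t⁻¹ ∈ KN) {u : G} (hu : u ∈ KN) (n : ℕ) :
    t ^ n * u * (t ^ n)⁻¹ ∈ KN := by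
  induction n with
  | zero => simpa using hu
  | succ n ih =>
    have h : t ^ (n + 1) * u * (t ^ (n + 1))⁻¹ = t * (t ^ n * u * (t ^ n)⁻¹) * t⁻¹ := by
      rw [pow_succ']; group
    rw [h]
    exact ht _ ih

/-- **Top cell**: for `u ∈ K_N ≤ K` and `x = u·t` (i.e. `x t⁻¹ ∈ K_N`), `tⁿ x = (tⁿ u t⁻ⁿ)·t^{n+1} ∈ K t^{n+1} K`.
[cite: BruhatTits1972, (4.4.4)] [cite: SerreTrees1980, II.1.1] -/
theorem pow_mul_mem_doubleCoset_succ_of_mul_inv_mem (hKN : KN ≤ K) (ht : ∀ u ∈ KN, t * u * t⁻¹ ∈ KN) {x : G}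
    (hx : x * t⁻¹ ∈ KN) (n : ℕ) :
    t ^ n * x ∈ DoubleCoset.doubleCoset (t ^ (n + 1)) (K : Set G) K := by
  refine DoubleCoset.mem_doubleCoset.2 ⟨t ^ n * (x * t⁻¹) * (t ^ n)⁻¹, hKN (conj_pow_mem ht hx n), 1, K.one_mem, ?_⟩
  simp only [mul_one, pow_succ, mul_assoc, inv_mul_cancel_left, inv_mul_cancel]

/-- **Middle cell**: if `t x t⁻¹ ∈ K_N ≤ K` then `tⁿ x = (tⁿ x t⁻ⁿ)·tⁿ ∈ K tⁿ K` for every `n ≥ 1`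
(`tⁿ x t⁻ⁿ = t^{n-1}(t x t⁻¹)t^{-(n-1)} ∈ K_N`). [cite: BruhatTits1972, (4.4.4)] [cite: SerreTrees1980, II.1.1] -/
theorem pow_mul_mem_doubleCoset_self_of_conj_mem (hKN : KN ≤ K) (ht : ∀ u ∈ KN, t * u * t⁻¹ ∈ KN) {x : G}
    (hx : t * x * t⁻¹ ∈ KN) {n : ℕ} (hn : 1 ≤ n) :
    t ^ n * x ∈ DoubleCoset.doubleCoset (t ^ n) (K : Set G) K := by
  obtain ⟨m, rfl⟩ := Nat.exists_eq_add_of_le' hn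
  have hmem : t ^ m * (t * x * t⁻¹) * (t ^ m)⁻¹ ∈ KN := conj_pow_mem ht hx m
  refine DoubleCoset.mem_doubleCoset.2 ⟨t ^ m * (t * x * t⁻¹) * (t ^ m)⁻¹, hKN hmem, 1, K.one_mem, ?_⟩
  rw [mul_one, pow_succ]
  group

/-- **Bottom cell**: `tⁿ t⁻¹ = t^{n-1} ∈ K t^{n-1} K` for `n ≥ 1`. [cite: SerreTrees1980, II.1.1] -/
theorem pow_mul_inv_mem_doubleCoset_pred {n : ℕ} (hn : 1 ≤ n) :
    t ^ n * t⁻¹ ∈ DoubleCoset.doubleCoset (t ^ (n - 1)) (K : Set G) K := by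
  obtain ⟨m, rfl⟩ := Nat.exists_eq_add_of_le' hn
  rw [Nat.add_sub_cancel, pow_succ, mul_inv_cancel_right]
  exact DoubleCoset.mem_doubleCoset_self K K _

end Contracting

/-! ## §2 The counts: a contracting transversal is distance-regular -/

section Counts

variable {G : Type*} [Group G] [DecidableEq G] {K KN : Subgroup G} {t : G}

omit [DecidableEq G] in
/-- Plumbing: if `tⁿ x` lies in the shell `K t^i K` for every `x ∈ A` and `tⁿ y ∈ K t^j K` with `i ≠ j` and the shells disjoint, then `y ∉ A`.
[cite: SerreTrees1980, II.1.1] -/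
theorem not_mem_of_translates_disjoint
    (hD : ∀ m n : ℕ, m ≠ n → Disjoint (DoubleCoset.doubleCoset (t ^ m) (K : Set G) K) (DoubleCoset.doubleCoset (t ^ n) (K : Set G) K))
    {A : Finset G} {n i j : ℕ} (hij : i ≠ j) (hA : ∀ x ∈ A, t ^ n * x ∈ DoubleCoset.doubleCoset (t ^ i) (K : Set G) K) {y : G}
    (hy : t ^ n * y ∈ DoubleCoset.doubleCoset (t ^ j) (K : Set G) K) : y ∉ A :=
  fun hyA => Set.disjoint_left.1 (hD i j hij) (hA y hyA) hy

/-- **A contracting transversal is distance-regular.**  Let `K_N ≤ K`, `t K_N t⁻¹ ≤ K_N`, the shells `K t^m K` (`m ∈ ℕ`) pairwise disjoint, and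
`X = X₊ ∪ X₀ ∪ {t⁻¹}` with `x t⁻¹ ∈ K_N` for `x ∈ X₊` and `t x t⁻¹ ∈ K_N` for `x ∈ X₀`.  Then for every `n ≥ 1`:
`#{x ∈ X : tⁿx ∈ K t^{n+1} K} = |X₊|`, `#{x ∈ X : tⁿx ∈ K tⁿ K} = |X₀|`, `#{x ∈ X : tⁿx ∈ K t^{n-1} K} = 1`, and every `tⁿ x` (`x ∈ X`) lies in
one of the three shells — the hypothesis `hreg` of ★ `not_isSquareIntegrableModCenter_of_isSpherical_of_symm`, token for token.
[cite: BruhatTits1972, (4.4.4)] [cite: SerreTrees1980, II.1.1] [cite: Macdonald1971, Ch. V §3] -/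
theorem ncard_translates_of_contracting (hKN : KN ≤ K) (ht : ∀ u ∈ KN, t * u * t⁻¹ ∈ KN)
    (hD : ∀ m n : ℕ, m ≠ n → Disjoint (DoubleCoset.doubleCoset (t ^ m) (K : Set G) K) (DoubleCoset.doubleCoset (t ^ n) (K : Set G) K))
    {Xp X0 : Finset G} (hXp : ∀ x ∈ Xp, x * t⁻¹ ∈ KN) (hX0 : ∀ x ∈ X0, t * x * t⁻¹ ∈ KN) {n : ℕ} (hn : 1 ≤ n) :
    {x | x ∈ Xp ∪ X0 ∪ {t⁻¹} ∧ t ^ n * x ∈ DoubleCoset.doubleCoset (t ^ (n + 1)) (K : Set G) K}.ncard = Xp.card ∧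
    {x | x ∈ Xp ∪ X0 ∪ {t⁻¹} ∧ t ^ n * x ∈ DoubleCoset.doubleCoset (t ^ n) (K : Set G) K}.ncard = X0.card ∧
    {x | x ∈ Xp ∪ X0 ∪ {t⁻¹} ∧ t ^ n * x ∈ DoubleCoset.doubleCoset (t ^ (n - 1)) (K : Set G) K}.ncard = 1 ∧
    ∀ x ∈ Xp ∪ X0 ∪ {t⁻¹}, t ^ n * x ∈ DoubleCoset.doubleCoset (t ^ (n + 1)) (K : Set G) K ∨
      t ^ n * x ∈ DoubleCoset.doubleCoset (t ^ n) (K : Set G) K ∨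
      t ^ n * x ∈ DoubleCoset.doubleCoset (t ^ (n - 1)) (K : Set G) K := by
  -- the three memberships
  have hp : ∀ x ∈ Xp, t ^ n * x ∈ DoubleCoset.doubleCoset (t ^ (n + 1)) (K : Set G) K := fun x hx =>
    pow_mul_mem_doubleCoset_succ_of_mul_inv_mem hKN ht (hXp x hx) n
  have h0 : ∀ x ∈ X0, t ^ n * x ∈ DoubleCoset.doubleCoset (t ^ n) (K : Set G) K := fun x hx =>
    pow_mul_mem_doubleCoset_self_of_conj_mem hKN ht (hX0 x hx) hn
  have hm : t ^ n * t⁻¹ ∈ DoubleCoset.doubleCoset (t ^ (n - 1)) (K : Set G) K := pow_mul_inv_mem_doubleCoset_pred hn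
  have hm' : ∀ x ∈ ({t⁻¹} : Finset G), t ^ n * x ∈ DoubleCoset.doubleCoset (t ^ (n - 1)) (K : Set G) K := fun x hx => by
    rw [Finset.mem_singleton] at hx; subst hx; exact hm
  -- the index inequalities
  have h1 : n + 1 ≠ n := Nat.succ_ne_self n
  have h2 : n + 1 ≠ n - 1 := by omega
  have h3 : n ≠ n - 1 := by omega
  -- identify the three sets
  have eqp : {x | x ∈ Xp ∪ X0 ∪ {t⁻¹} ∧ t ^ n * x ∈ DoubleCoset.doubleCoset (t ^ (n + 1)) (K : Set G) K} = (Xp : Set G) := by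
    ext x
    simp only [Set.mem_setOf_eq, Finset.mem_coe, Finset.mem_union]
    constructor
    · rintro ⟨(hx | hx) | hx, hmem⟩
      · exact hx
      · exact (not_mem_of_translates_disjoint hD h1.symm h0 hmem hx).elim
      · exact (not_mem_of_translates_disjoint hD h2.symm hm' hmem hx).elim
    · exact fun hx => ⟨Or.inl (Or.inl hx), hp x hx⟩
  have eq0 : {x | x ∈ Xp ∪ X0 ∪ {t⁻¹} ∧ t ^ n * x ∈ DoubleCoset.doubleCoset (t ^ n) (K : Set G) K} = (X0 : Set G) := by
    ext x
    simp only [Set.mem_setOf_eq, Finset.mem_coe, Finset.mem_union]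
    constructor
    · rintro ⟨(hx | hx) | hx, hmem⟩
      · exact (not_mem_of_translates_disjoint hD h1 hp hmem hx).elim
      · exact hx
      · exact (not_mem_of_translates_disjoint hD h3.symm hm' hmem hx).elim
    · exact fun hx => ⟨Or.inl (Or.inr hx), h0 x hx⟩
  have eqm : {x | x ∈ Xp ∪ X0 ∪ {t⁻¹} ∧ t ^ n * x ∈ DoubleCoset.doubleCoset (t ^ (n - 1)) (K : Set G) K} = ({t⁻¹} : Set G) := by
    ext x
    simp only [Set.mem_setOf_eq, Finset.mem_union, Set.mem_singleton_iff]
    constructor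
    · rintro ⟨(hx | hx) | hx, hmem⟩
      · exact (not_mem_of_translates_disjoint hD h2 hp hmem hx).elim
      · exact (not_mem_of_translates_disjoint hD h3 h0 hmem hx).elim
      · exact Finset.mem_singleton.1 hx
    · intro hx; subst hx; exact ⟨Or.inr (Finset.mem_singleton_self _), hm⟩
  refine ⟨by rw [eqp, Set.ncard_coe_finset], by rw [eq0, Set.ncard_coe_finset], by rw [eqm, Set.ncard_singleton], ?_⟩
  intro x hx
  rcases Finset.mem_union.1 hx with hx | hx
  · rcases Finset.mem_union.1 hx with hx | hx
    · exact Or.inl (hp x hx)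
    · exact Or.inr (Or.inl (h0 x hx))
  · exact Or.inr (Or.inr (hm' x hx))

/-- **The pieces of a contracting transversal are pairwise disjoint** (forced by the disjointness of the shells at `n = 1`), so
`#(X₊ ∪ X₀ ∪ {t⁻¹}) = |X₊| + |X₀| + 1`. [cite: SerreTrees1980, II.1.1] -/
theorem card_contractingTransversal (hKN : KN ≤ K) (ht : ∀ u ∈ KN, t * u * t⁻¹ ∈ KN)
    (hD : ∀ m n : ℕ, m ≠ n → Disjoint (DoubleCoset.doubleCoset (t ^ m) (K : Set G) K) (DoubleCoset.doubleCoset (t ^ n) (K : Set G) K))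
    {Xp X0 : Finset G} (hXp : ∀ x ∈ Xp, x * t⁻¹ ∈ KN) (hX0 : ∀ x ∈ X0, t * x * t⁻¹ ∈ KN) :
    (Xp ∪ X0 ∪ {t⁻¹}).card = Xp.card + X0.card + 1 := by
  have hp : ∀ x ∈ Xp, t ^ 1 * x ∈ DoubleCoset.doubleCoset (t ^ (1 + 1)) (K : Set G) K := fun x hx =>
    pow_mul_mem_doubleCoset_succ_of_mul_inv_mem hKN ht (hXp x hx) 1
  have h0 : ∀ x ∈ X0, t ^ 1 * x ∈ DoubleCoset.doubleCoset (t ^ 1) (K : Set G) K := fun x hx =>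
    pow_mul_mem_doubleCoset_self_of_conj_mem hKN ht (hX0 x hx) le_rfl
  have hm : t ^ 1 * t⁻¹ ∈ DoubleCoset.doubleCoset (t ^ (1 - 1)) (K : Set G) K := pow_mul_inv_mem_doubleCoset_pred le_rfl
  have hd1 : Disjoint Xp X0 := Finset.disjoint_left.2 fun x hx hx0 =>
    not_mem_of_translates_disjoint hD (by norm_num) hp (h0 x hx0) hx
  have hd2 : Disjoint (Xp ∪ X0) {t⁻¹} := by
    rw [Finset.disjoint_singleton_right, Finset.mem_union, not_or]
    exact ⟨not_mem_of_translates_disjoint hD (by norm_num) hp hm, not_mem_of_translates_disjoint hD (by norm_num) h0 hm⟩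
  rw [Finset.card_union_of_disjoint hd2, Finset.card_union_of_disjoint hd1, Finset.card_singleton]

end Counts

/-! ## §3 Junction with ★ L4γ -/

section Main

variable {G V : Type*} [Group G] [DecidableEq G] [TopologicalSpace G] [IsTopologicalGroup G] [AddCommGroup V] [Module ℂ V]
  [MeasurableSpace (G ⧸ Subgroup.center G)] [BorelSpace (G ⧸ Subgroup.center G)]
  {ρ : Representation ℂ G V} {K KN : Subgroup G}

/-- **`K`-spherical + a CONTRACTING transversal of `KtK/K` of type `(ab, b-1, 1)` with `b ≤ a`, `ab ≥ 2` ⇒ not square-integrable modulo the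
centre.**  Hypotheses on `(G, K, K_N, t)`: `K` compact open ⊇ `Z(G)`; `K_N ≤ K` with `t K_N t⁻¹ ≤ K_N`; `t⁻¹ ∈ KtK`; the shells `K tⁿ K` pairwise
disjoint; finite sets `X₊` (`x t⁻¹ ∈ K_N`, `|X₊| = ab`) and `X₀` (`t x t⁻¹ ∈ K_N`, `|X₀| = b - 1`) such that `X₊ ∪ X₀ ∪ {t⁻¹}` is a transversal of
`KtK/K`.  Then no smooth `K`-spherical `ρ` is square-integrable modulo the centre for any Haar measure on `G ⧸ Z(G)` — ★ L4γ
`not_isSquareIntegrableModCenter_of_isSpherical_of_symm` with `hcard` and `hreg` discharged by §2.  For the unramified `U(3)` and its hyperspecial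
`K`: `K_N = N(𝒪)`, `t = diag(ϖ, 1, ϖ⁻¹)`, `X₊ = (N(𝒪)/tN(𝒪)t⁻¹)·t` (`q⁴`), `X₀ = {u(0,y)}` (`q - 1`), `(a, b) = (q³, q)`.
[cite: Macdonald1971, Ch. V §3] [cite: BruhatTits1972, (4.4.4)] [cite: SerreTrees1980, II.1.1] [cite: HarishChandra1970, Part I §1 p. 4] -/
theorem not_isSquareIntegrableModCenter_of_isSpherical_of_contracting {a b : ℕ} (hba : b ≤ a) (hab : 2 ≤ a * b)
    (hKo : IsOpen (K : Set G)) (hKc : IsCompact (K : Set G)) (hZK : Subgroup.center G ≤ K) (hKN : KN ≤ K) {t : G}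
    (ht : ∀ u ∈ KN, t * u * t⁻¹ ∈ KN) (hsymm : t⁻¹ ∈ DoubleCoset.doubleCoset t (K : Set G) K)
    (hD : ∀ m n : ℕ, m ≠ n → Disjoint (DoubleCoset.doubleCoset (t ^ m) (K : Set G) K) (DoubleCoset.doubleCoset (t ^ n) (K : Set G) K))
    {Xp X0 : Finset G} (hXp : ∀ x ∈ Xp, x * t⁻¹ ∈ KN) (hX0 : ∀ x ∈ X0, t * x * t⁻¹ ∈ KN)
    (hX : Set.BijOn (fun x : G => (x : G ⧸ K)) (Xp ∪ X0 ∪ {t⁻¹} : Finset G) (orbit K (t : G ⧸ K)))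
    (hcardp : Xp.card = a * b) (hcard0 : X0.card = b - 1)
    (hρ : ρ.IsSmooth) (h1 : ρ.IsSpherical K) (μ : Measure (G ⧸ Subgroup.center G)) [μ.IsHaarMeasure] :
    ¬ ρ.IsSquareIntegrableModCenter μ := by
  have hb : 1 ≤ b := by
    rcases Nat.eq_zero_or_pos b with h | h
    · subst h; simp at hab
    · exact h
  have hcard : (Xp ∪ X0 ∪ {t⁻¹}).card = (a + 1) * b := by
    rw [card_contractingTransversal hKN ht hD hXp hX0, hcardp, hcard0, add_mul, one_mul, add_assoc, Nat.sub_add_cancel hb]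
  refine not_isSquareIntegrableModCenter_of_isSpherical_of_symm hba hab hKo hKc hZK hsymm hD hX hcard (fun n hn => ?_) hρ h1 μ
  obtain ⟨e1, e2, e3, e4⟩ := ncard_translates_of_contracting hKN ht hD hXp hX0 hn
  exact ⟨e1.trans hcardp, e2.trans hcard0, e3, e4⟩

end Main

end Literature.NumberTheory.Automorphic.SphericalCoefficient

end
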